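import Literature.Geometry.Riemannian.UnwindingShell
import Mathlib.Analysis.Calculus.InverseFunctionTheorem.FDeriv
import HarnessLib

/-!
# The interior surgery map: a smooth injective immersion of the ball extending the collar cone map

Topic `Geometry/Riemannian`. The conclusion of the `Unwinding*` files (Weinstein 1968, proof of
the main theorem, step (3), in the round picture): let `C : V → V` be `C^∞` on an annulus
`{1-ε < ‖v‖ < 1+ε}`, equal to the identity on the unit sphere, with the normalisation
`1 ≤ ⟪u, DC_u(u)⟫` there (for the collar cone map of the boundary sphere of Weinstein's disk this is
`⟪u, ν(u)⟫ = √q ≥ 1`, arranged by a global rescaling of the metric). Then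

* `exists_unwinding_extension` (and `exists_unwinding_extension_norm_lt`, with the image bound
  `‖F‖ < 1 + ε`) — **there are `δ ∈ (0, ε)` and `F : V → V`, `C^∞` on the ball
  `B(0, 1+δ)`, with `F = id` on `B(0, 1/3)`, `F = C` on `{1-δ ≤ ‖v‖ < 1+δ}`, injective on
  `B(0, 1+δ)` and with injective differential at every point of `B(0, 1+δ)`.**

`F(v) = R(‖v‖, v) Θ(‖v‖, v)` with the polar data of `UnwindingShell.lean`; injectivity is the shell
lemma, the immersion property follows from the local co-Lipschitz bound
(`PolarGraphCoLipschitz.injective_of_coLipschitz_hasFDerivAt`) — no derivative of the formula is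
ever computed.

## References

* A. Weinstein, Ann. of Math. (2) 87 (1968), 29–41, proof of the main theorem, step (3).
  [cite: Weinstein1968]

Tags: [ConeMap] [Surgery] [Weinstein1968]
-/

noncomputable section

open Set Function Metric Filter Real
open scoped Topology RealInnerProductSpace ContDiff

namespace Literature.Geometry.Riemannian

variable {V : Type*} [NormedAddCommGroup V] [InnerProductSpace ℝ V] [FiniteDimensional ℝ V]

omit [FiniteDimensional ℝ V] in
/-- `N(N v) = N v` for `v ≠ 0`. [folklore] -/
theorem normalize_normalize {v : V} (hv : v ≠ 0) :
    ‖‖v‖⁻¹ • v‖⁻¹ • (‖v‖⁻¹ • v) = ‖v‖⁻¹ • v := by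
  have hn : ‖‖v‖⁻¹ • v‖ = 1 := by
    rw [norm_smul, norm_inv, norm_norm, inv_mul_cancel₀ (norm_ne_zero_iff.2 hv)]
  rw [hn, inv_one, one_smul]

set_option maxHeartbeats 1600000 in
/-- **The interior surgery map, with image bound and preservation of the unit ball.** As
`exists_unwinding_extension_norm_lt`, and moreover `‖F v‖ < 1` for `‖v‖ < 1`, `F v = v` for
`‖v‖ = 1`, and `F` maps the closed unit ball ONTO the closed unit ball.
[cite: Weinstein1968, proof of the main theorem, step (3)] -/
theorem exists_unwinding_extension_ball {C : V → V} {ε : ℝ} (hε : 0 < ε)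
    (hCs : ContDiffOn ℝ ∞ C {v : V | 1 - ε < ‖v‖ ∧ ‖v‖ < 1 + ε})
    (hCid : ∀ u : V, ‖u‖ = 1 → C u = u) (hCtr : ∀ u : V, ‖u‖ = 1 → 1 ≤ ⟪u, fderiv ℝ C u u⟫) :
    ∃ δ : ℝ, 0 < δ ∧ δ < ε ∧ ∃ F : V → V,
      ContDiffOn ℝ ∞ F (ball (0 : V) (1 + δ)) ∧
      (∀ v : V, ‖v‖ ≤ 1 / 3 → F v = v) ∧
      (∀ v : V, 1 - δ ≤ ‖v‖ → ‖v‖ < 1 + δ → F v = C v) ∧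
      InjOn F (ball (0 : V) (1 + δ)) ∧
      (∀ v ∈ ball (0 : V) (1 + δ), Injective (fderiv ℝ F v)) ∧
      (∀ v ∈ ball (0 : V) (1 + δ), ‖F v‖ < 1 + ε) ∧
      (∀ v : V, ‖v‖ < 1 → ‖F v‖ < 1) ∧
      (∀ v : V, ‖v‖ = 1 → F v = v) ∧
      closedBall (0 : V) 1 ⊆ F '' closedBall (0 : V) 1 := by
  /- ── a collar width `ε' ≤ 1/2` on which `C` is `C¹`, close to `N` and nonvanishing ── -/
  set ε₀ : ℝ := min ε (1 / 2) with hε₀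
  have hε₀pos : 0 < ε₀ := lt_min hε (by norm_num)
  have hε₀ε : ε₀ ≤ ε := min_le_left _ _
  have hε₀1 : ε₀ ≤ 1 := (min_le_right _ _).trans (by norm_num)
  have hA₀ : {v : V | 1 - ε₀ < ‖v‖ ∧ ‖v‖ < 1 + ε₀} ⊆ {v : V | 1 - ε < ‖v‖ ∧ ‖v‖ < 1 + ε} :=
    fun v hv ↦ ⟨by linarith [hv.1], by linarith [hv.2]⟩
  obtain ⟨ε₃, hε₃, hε₃ε₀, hclose₃⟩ := exists_collar_width hε₀pos hε₀1
    ((hCs.continuousOn).mono hA₀) hCid (κ := 1 / 2) (by norm_num)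
  obtain ⟨ε₂, hε₂, hε₂ε₀, hclose₂'⟩ := exists_collar_width hε₀pos hε₀1
    ((hCs.continuousOn).mono hA₀) hCid (κ := ε₀ / 4) (by positivity)
  set ε' : ℝ := min ε₃ (min ε₂ (ε₀ / 4)) with hε'def
  have hε' : 0 < ε' := by rw [hε'def]; positivity
  have hε'ε₀ : ε' < ε₀ := (min_le_left _ _).trans_lt hε₃ε₀
  have hε'q : ε' ≤ ε₀ / 4 := (min_le_right _ _).trans (min_le_right _ _)
  have hclose : ∀ σ : ℝ, |σ - 1| ≤ ε' → ∀ u : V, u ≠ 0 →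
      ‖C (σ • (‖u‖⁻¹ • u)) - ‖u‖⁻¹ • u‖ < 1 / 2 := fun σ hσ u hu ↦
    hclose₃ σ (hσ.trans (min_le_left _ _)) u hu
  have hclose₂ : ∀ σ : ℝ, |σ - 1| ≤ ε' → ∀ u : V, u ≠ 0 →
      ‖C (σ • (‖u‖⁻¹ • u)) - ‖u‖⁻¹ • u‖ < ε₀ / 4 := fun σ hσ u hu ↦
    hclose₂' σ (hσ.trans ((min_le_right _ _).trans (min_le_left _ _))) u hu
  have hε'half : ε' ≤ 1 / 2 := (hε'ε₀.le).trans (min_le_right _ _)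
  have hε'ε : ε' < ε := hε'ε₀.trans_le hε₀ε
  have hε'1 : ε' < 1 := by linarith
  have hAε' : {v : V | 1 - ε' < ‖v‖ ∧ ‖v‖ < 1 + ε'} ⊆ {v : V | 1 - ε < ‖v‖ ∧ ‖v‖ < 1 + ε} :=
    fun v hv ↦ ⟨by linarith [hv.1], by linarith [hv.2]⟩
  have hCsm : ContDiffOn ℝ ∞ C {v : V | 1 - ε' < ‖v‖ ∧ ‖v‖ < 1 + ε'} := hCs.mono hAε'
  have hC1 : ContDiffOn ℝ 1 C {v : V | 1 - ε' < ‖v‖ ∧ ‖v‖ < 1 + ε'} :=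
    hCsm.of_le (by exact_mod_cast le_top)
  -- `‖C v - N v‖ < 1/2` on the annulus, hence `C v ≠ 0`
  have hCN : ∀ v : V, 1 - ε' < ‖v‖ → ‖v‖ < 1 + ε' → ‖C v - ‖v‖⁻¹ • v‖ < 1 / 2 := by
    intro v h1 h2
    have hv0 : v ≠ 0 := by
      intro h; rw [h, norm_zero] at h1; linarith
    have h := hclose ‖v‖ (abs_le.2 ⟨by linarith, by linarith⟩) v hv0
    rwa [smul_inv_smul₀ (norm_ne_zero_iff.2 hv0)] at h
  have hC0 : ∀ v : V, 1 - ε' < ‖v‖ → ‖v‖ < 1 + ε' → C v ≠ 0 := by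
    intro v h1 h2 h0
    have hv0 : v ≠ 0 := by
      intro h; rw [h, norm_zero] at h1; linarith
    have h := hCN v h1 h2
    rw [h0, zero_sub, norm_neg, norm_smul, norm_inv, norm_norm,
      inv_mul_cancel₀ (norm_ne_zero_iff.2 hv0)] at h
    linarith
  /- ── the shell package ── -/
  obtain ⟨ε₁, hε₁, hε₁ε', hε₁4, hshell⟩ := unwinding_shell₂ hε' hε'half hC1 hC0 hCid hCtr
  have hε₁ε'' : ε₁ < ε' := by linarith
  -- the polar data
  set cl : ℝ → ℝ := fun ρ ↦ (1 - ε₁) + ε₁ / 2 * ((ρ - (1 - ε₁)) / (ε₁ / 2) *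
    smoothTransition ((ρ - (1 - ε₁)) / (ε₁ / 2))) with hcl
  set χ : ℝ → ℝ := fun ρ ↦ smoothTransition (3 * ρ - 1) with hχ
  set R : ℝ → V → ℝ := fun ρ u ↦ ρ + χ ρ * (‖C (cl ρ • (‖u‖⁻¹ • u))‖ - cl ρ) with hRdef
  set Θ : ℝ → V → V := fun ρ u ↦
    ‖‖u‖⁻¹ • u + χ ρ • (‖C (cl ρ • (‖u‖⁻¹ • u))‖⁻¹ • C (cl ρ • (‖u‖⁻¹ • u)) - ‖u‖⁻¹ • u)‖⁻¹ •
      (‖u‖⁻¹ • u + χ ρ • (‖C (cl ρ • (‖u‖⁻¹ • u))‖⁻¹ • C (cl ρ • (‖u‖⁻¹ • u)) - ‖u‖⁻¹ • u))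
    with hΘdef
  obtain ⟨hinj, hco, hRΘ, hgrowth⟩ := hshell R Θ (fun _ _ ↦ rfl) (fun _ _ ↦ rfl)
  set F : V → V := fun v ↦ R ‖v‖ v • Θ ‖v‖ v with hFdef
  -- `0`-homogeneity in the direction slot
  have hR0 : ∀ ρ, ∀ v : V, v ≠ 0 → R ρ v = R ρ (‖v‖⁻¹ • v) := by
    intro ρ v hv; simp only [hRdef, normalize_normalize hv]
  have hΘ0 : ∀ ρ, ∀ v : V, v ≠ 0 → Θ ρ v = Θ ρ (‖v‖⁻¹ • v) := by
    intro ρ v hv; simp only [hΘdef, normalize_normalize hv]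
  have hFpolar : ∀ v : V, v ≠ 0 → F v = R ‖v‖ (‖v‖⁻¹ • v) • Θ ‖v‖ (‖v‖⁻¹ • v) := by
    intro v hv; simp only [hFdef]; rw [hR0 _ v hv, hΘ0 _ v hv]
  have hNsph : ∀ v : V, v ≠ 0 → ‖v‖⁻¹ • v ∈ Metric.sphere (0 : V) 1 := by
    intro v hv
    rw [mem_sphere_zero_iff_norm, norm_smul, norm_inv, norm_norm,
      inv_mul_cancel₀ (norm_ne_zero_iff.2 hv)]
  -- the clamp value is within `ε₁` of `1`
  have hcl1 : ∀ ρ, ρ ≤ 1 + ε₁ → |cl ρ - 1| ≤ ε₁ := by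
    intro ρ hρ
    have h1 : 1 - ε₁ ≤ cl ρ := le_clamp hε₁ ρ
    have h2 : cl ρ ≤ max ρ (1 - ε₁) := by
      rcases le_or_gt (1 - ε₁) ρ with h | h
      · exact (clamp_le_self hε₁ h).trans (le_max_left _ _)
      · rw [show cl ρ = 1 - ε₁ from clamp_of_le hε₁ h.le]; exact le_max_right _ _
    rw [abs_le]; constructor
    · linarith
    · have : max ρ (1 - ε₁) ≤ 1 + ε₁ := max_le hρ (by linarith); linarith
  /- ── `F = id` near `0` and `F = C` on the collar ── -/
  have hF0 : F 0 = 0 := by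
    have : R 0 0 = 0 := by
      simp only [hRdef, hχ]
      rw [show (3 : ℝ) * 0 - 1 = -1 by norm_num, smoothTransition.zero_of_nonpos (by norm_num)]
      ring
    simp only [hFdef]
    rw [norm_zero, this, zero_smul]
  have hFid : ∀ v : V, ‖v‖ ≤ 1 / 3 → F v = v := by
    intro v hv
    by_cases hv0 : v = 0
    · rw [hv0, hF0]
    · have hχ0 : χ ‖v‖ = 0 := chi_eq_zero hv
      simp only [hFdef, hRdef, hΘdef, hχ0, zero_mul, add_zero, zero_smul, normalize_normalize hv0]
      rw [smul_inv_smul₀ (norm_ne_zero_iff.2 hv0)]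
  set δ : ℝ := ε₁ / 2 with hδ
  have hδpos : 0 < δ := by rw [hδ]; linarith
  have hFC : ∀ v : V, 1 - δ ≤ ‖v‖ → ‖v‖ < 1 + δ → F v = C v := by
    intro v h1 h2
    have hv0 : v ≠ 0 := by
      intro h; rw [h, norm_zero] at h1; linarith
    have hχ1 : χ ‖v‖ = 1 := chi_eq_one (by rw [hδ] at h1; linarith)
    have hclv : cl ‖v‖ = ‖v‖ := clamp_of_ge hε₁ (by rw [hδ] at h1; linarith)
    have hann : 1 - ε' < ‖v‖ ∧ ‖v‖ < 1 + ε' := ⟨by rw [hδ] at h1; linarith, by rw [hδ] at h2; linarith⟩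
    have hCv0 : C v ≠ 0 := hC0 v hann.1 hann.2
    simp only [hFdef, hRdef, hΘdef, hχ1, one_mul, one_smul, hclv, smul_inv_smul₀ (norm_ne_zero_iff.2 hv0),
      add_sub_cancel, normalize_normalize hCv0]
    rw [smul_inv_smul₀ (norm_ne_zero_iff.2 hCv0)]
  /- ── injectivity on the ball ── -/
  have hFnorm : ∀ v : V, v ≠ 0 → ‖v‖ ≤ 1 + ε₁ → ‖F v‖ = R ‖v‖ (‖v‖⁻¹ • v) := by
    intro v hv hvle
    have hJ : ‖v‖ ∈ Ioc (0 : ℝ) (1 + ε₁) := ⟨norm_pos_iff.2 hv, hvle⟩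
    obtain ⟨hRp, hΘn⟩ := hRΘ ‖v‖ hJ (‖v‖⁻¹ • v) (hNsph v hv)
    rw [hFpolar v hv, norm_smul, hΘn, mul_one, Real.norm_eq_abs, abs_of_pos hRp]
  have hFne : ∀ v : V, v ≠ 0 → ‖v‖ ≤ 1 + ε₁ → F v ≠ 0 := by
    intro v hv hvle h0
    have h := hFnorm v hv hvle
    rw [h0, norm_zero] at h
    have hJ : ‖v‖ ∈ Ioc (0 : ℝ) (1 + ε₁) := ⟨norm_pos_iff.2 hv, hvle⟩
    have := (hRΘ ‖v‖ hJ (‖v‖⁻¹ • v) (hNsph v hv)).1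
    linarith
  have hFinj : InjOn F (ball (0 : V) (1 + δ)) := by
    intro v hv v' hv' heq
    rw [mem_ball_zero_iff] at hv hv'
    have hvle : ‖v‖ ≤ 1 + ε₁ := by rw [hδ] at hv; linarith
    have hv'le : ‖v'‖ ≤ 1 + ε₁ := by rw [hδ] at hv'; linarith
    by_cases hv0 : v = 0
    · by_cases hv0' : v' = 0
      · rw [hv0, hv0']
      · exfalso
        rw [hv0, hF0] at heq
        exact hFne v' hv0' hv'le heq.symm
    · by_cases hv0' : v' = 0
      · exfalso
        rw [hv0', hF0] at heq
        exact hFne v hv0 hvle heq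
      · rw [hFpolar v hv0, hFpolar v' hv0'] at heq
        have hmem1 : (‖v‖, ‖v‖⁻¹ • v) ∈ Ioc (0 : ℝ) (1 + ε₁) ×ˢ Metric.sphere (0 : V) 1 :=
          ⟨⟨norm_pos_iff.2 hv0, hvle⟩, hNsph v hv0⟩
        have hmem2 : (‖v'‖, ‖v'‖⁻¹ • v') ∈ Ioc (0 : ℝ) (1 + ε₁) ×ˢ Metric.sphere (0 : V) 1 :=
          ⟨⟨norm_pos_iff.2 hv0', hv'le⟩, hNsph v' hv0'⟩
        have h : ((‖v‖, ‖v‖⁻¹ • v) : ℝ × V) = (‖v'‖, ‖v'‖⁻¹ • v') := hinj hmem1 hmem2 heq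
        obtain ⟨h1, h2⟩ := Prod.mk.inj h
        have e1 : v = ‖v‖ • (‖v‖⁻¹ • v) := (smul_inv_smul₀ (norm_ne_zero_iff.2 hv0) v).symm
        have e2 : v' = ‖v'‖ • (‖v'‖⁻¹ • v') := (smul_inv_smul₀ (norm_ne_zero_iff.2 hv0') v').symm
        rw [e1, e2, h2, h1]
  /- ── smoothness ── -/
  have hann_open : IsOpen {v : V | 1 - ε < ‖v‖ ∧ ‖v‖ < 1 + ε} :=
    (isOpen_lt continuous_const continuous_norm).inter (isOpen_lt continuous_norm continuous_const)
  have hFsmooth_at : ∀ v : V, v ≠ 0 → ‖v‖ < 1 + ε₁ → ContDiffAt ℝ ∞ F v := by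
    intro v hv0 hvlt
    -- pieces
    have hn : ContDiffAt ℝ ∞ (fun x : V ↦ ‖x‖) v := contDiffAt_norm ℝ hv0
    have hN : ContDiffAt ℝ ∞ (fun x : V ↦ ‖x‖⁻¹ • x) v := contDiffAt_normalize hv0
    have hχn : ContDiffAt ℝ ∞ (fun x : V ↦ χ ‖x‖) v :=
      (contDiff_chi (n := ⊤)).contDiffAt.comp v hn
    have hcln : ContDiffAt ℝ ∞ (fun x : V ↦ cl ‖x‖) v :=
      (contDiff_clamp (n := ⊤) (ε := ε₁)).contDiffAt.comp v hn
    have hpt : ContDiffAt ℝ ∞ (fun x : V ↦ cl ‖x‖ • (‖x‖⁻¹ • x)) v := hcln.smul hN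
    -- the clamped point lies in the annulus where `C` is smooth and nonzero
    have hclv : |cl ‖v‖ - 1| ≤ ε₁ := hcl1 ‖v‖ hvlt.le
    have hmem' : 1 - ε' < ‖cl ‖v‖ • (‖v‖⁻¹ • v)‖ ∧ ‖cl ‖v‖ • (‖v‖⁻¹ • v)‖ < 1 + ε' := by
      have h := abs_le.1 hclv
      have hclpos : 0 < cl ‖v‖ := by linarith
      rw [norm_smul, Real.norm_eq_abs, abs_of_pos hclpos, norm_smul, norm_inv, norm_norm,
        inv_mul_cancel₀ (norm_ne_zero_iff.2 hv0), mul_one]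
      exact ⟨by linarith, by linarith⟩
    have hmem : cl ‖v‖ • (‖v‖⁻¹ • v) ∈ {v : V | 1 - ε < ‖v‖ ∧ ‖v‖ < 1 + ε} := hAε' hmem'
    have hCat : ContDiffAt ℝ ∞ C (cl ‖v‖ • (‖v‖⁻¹ • v)) := hCs.contDiffAt (hann_open.mem_nhds hmem)
    have hCpt : ContDiffAt ℝ ∞ (fun x : V ↦ C (cl ‖x‖ • (‖x‖⁻¹ • x))) v := hCat.comp v hpt
    have hC0v : C (cl ‖v‖ • (‖v‖⁻¹ • v)) ≠ 0 := hC0 _ hmem'.1 hmem'.2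
    have hCn : ContDiffAt ℝ ∞ (fun x : V ↦ ‖C (cl ‖x‖ • (‖x‖⁻¹ • x))‖) v := hCpt.norm ℝ hC0v
    have hNC : ContDiffAt ℝ ∞ ((fun y : V ↦ ‖y‖⁻¹ • y) ∘ fun x : V ↦ C (cl ‖x‖ • (‖x‖⁻¹ • x))) v :=
      (contDiffAt_normalize hC0v).comp v hCpt
    have hwt : ContDiffAt ℝ ∞ (fun x : V ↦
        ‖C (cl ‖x‖ • (‖x‖⁻¹ • x))‖⁻¹ • C (cl ‖x‖ • (‖x‖⁻¹ • x)) - ‖x‖⁻¹ • x) v := hNC.sub hN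
    have hP : ContDiffAt ℝ ∞ (fun x : V ↦ ‖x‖⁻¹ • x + χ ‖x‖ •
        (‖C (cl ‖x‖ • (‖x‖⁻¹ • x))‖⁻¹ • C (cl ‖x‖ • (‖x‖⁻¹ • x)) - ‖x‖⁻¹ • x)) v :=
      hN.add (hχn.smul hwt)
    -- `P v ≠ 0` since `‖Θ‖ = 1`
    have hPv : ‖v‖⁻¹ • v + χ ‖v‖ •
        (‖C (cl ‖v‖ • (‖v‖⁻¹ • v))‖⁻¹ • C (cl ‖v‖ • (‖v‖⁻¹ • v)) - ‖v‖⁻¹ • v) ≠ 0 := by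
      intro h0
      have hJ : ‖v‖ ∈ Ioc (0 : ℝ) (1 + ε₁) := ⟨norm_pos_iff.2 hv0, hvlt.le⟩
      have hΘn := (hRΘ ‖v‖ hJ (‖v‖⁻¹ • v) (hNsph v hv0)).2
      rw [← hΘ0 _ v hv0] at hΘn
      simp only [hΘdef] at hΘn
      rw [h0, smul_zero, norm_zero] at hΘn
      exact zero_ne_one hΘn
    have hΘt : ContDiffAt ℝ ∞ (fun x : V ↦ Θ ‖x‖ x) v := by
      have h := (contDiffAt_normalize hPv).comp v hP
      exact h
    have hRt : ContDiffAt ℝ ∞ (fun x : V ↦ R ‖x‖ x) v :=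
      hn.add (hχn.mul (hCn.sub hcln))
    exact hRt.smul hΘt
  have hFsmooth : ContDiffOn ℝ ∞ F (ball (0 : V) (1 + δ)) := by
    intro v hv
    rw [mem_ball_zero_iff] at hv
    by_cases hsmall : ‖v‖ < 1 / 3
    · -- `F = id` near `v`
      have hev : F =ᶠ[𝓝 v] id := by
        have hopen : IsOpen {x : V | ‖x‖ < 1 / 3} := isOpen_lt continuous_norm continuous_const
        filter_upwards [hopen.mem_nhds hsmall] with x hx
        exact hFid x (le_of_lt hx)
      exact (contDiffAt_id.congr_of_eventuallyEq hev).contDiffWithinAt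
    · have hv0 : v ≠ 0 := by
        intro h; rw [h, norm_zero] at hsmall; exact hsmall (by norm_num)
      exact (hFsmooth_at v hv0 (by rw [hδ] at hv; linarith)).contDiffWithinAt
  /- ── injective differentials from the local co-Lipschitz bound ── -/
  have hFdiff : ∀ v ∈ ball (0 : V) (1 + δ), HasFDerivAt F (fderiv ℝ F v) v := by
    intro v hv
    have h := (hFsmooth.contDiffAt (isOpen_ball.mem_nhds hv)).differentiableAt (by simp)
    exact h.hasFDerivAt
  have hcoLip : ∀ v ∈ ball (0 : V) (1 + δ), ∃ c : ℝ, 0 < c ∧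
      ∀ᶠ y in 𝓝 v, c * ‖y - v‖ ≤ ‖F y - F v‖ := by
    intro v hv
    rw [mem_ball_zero_iff] at hv
    by_cases hsmall : ‖v‖ < 1 / 3
    · refine ⟨1, one_pos, ?_⟩
      have hopen : IsOpen {x : V | ‖x‖ < 1 / 3} := isOpen_lt continuous_norm continuous_const
      filter_upwards [hopen.mem_nhds hsmall] with y hy
      rw [hFid y (le_of_lt hy), hFid v (le_of_lt hsmall), one_mul]
    · have hv0 : v ≠ 0 := by
        intro h; rw [h, norm_zero] at hsmall; exact hsmall (by norm_num)
      have hvpos : 0 < ‖v‖ := norm_pos_iff.2 hv0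
      obtain ⟨K, hK0, hK⟩ := hco (‖v‖ / 2) (by positivity)
      set M : ℝ := max 1 ‖v‖ with hM
      have hM1 : 1 ≤ M := le_max_left _ _
      refine ⟨1 / (M * K + 1), by positivity, ?_⟩
      -- neighbourhood: `‖y‖ ∈ [‖v‖/2, 1 + ε₁]` and `‖N y - N v‖ < 1`
      have hNcont : ContinuousAt (fun x : V ↦ ‖x‖⁻¹ • x) v := (contDiffAt_normalize (n := 0) hv0).continuousAt
      have h1 : ∀ᶠ y in 𝓝 v, ‖‖y‖⁻¹ • y - ‖v‖⁻¹ • v‖ < 1 := by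
        have := hNcont.eventually (Metric.ball_mem_nhds (‖v‖⁻¹ • v) one_pos)
        filter_upwards [this] with y hy
        have hy' : dist (‖y‖⁻¹ • y) (‖v‖⁻¹ • v) < 1 := hy
        rwa [dist_eq_norm] at hy'
      have h2 : ∀ᶠ y in 𝓝 v, ‖v‖ / 2 < ‖y‖ ∧ ‖y‖ < 1 + ε₁ := by
        have hc : ContinuousAt (fun x : V ↦ ‖x‖) v := continuous_norm.continuousAt
        have hlt : ‖v‖ < 1 + ε₁ := by rw [hδ] at hv; linarith
        exact (hc.eventually (Ioo_mem_nhds (by linarith) hlt))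
      filter_upwards [h1, h2] with y hy1 hy2
      have hy0 : y ≠ 0 := by
        intro h; rw [h, norm_zero] at hy2; linarith [hy2.1]
      have hyJ : ‖y‖ ∈ Icc (‖v‖ / 2) (1 + ε₁) := ⟨hy2.1.le, hy2.2.le⟩
      have hvJ : ‖v‖ ∈ Icc (‖v‖ / 2) (1 + ε₁) := ⟨by linarith, by rw [hδ] at hv; linarith⟩
      have hkey := hK ‖v‖ hvJ ‖y‖ hyJ (‖v‖⁻¹ • v) (hNsph v hv0) (‖y‖⁻¹ • y) (hNsph y hy0)
        (by rw [norm_sub_rev]; exact hy1)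
      rw [← hFpolar y hy0, ← hFpolar v hv0] at hkey
      -- `‖y - v‖ ≤ |‖y‖ - ‖v‖| + ‖v‖ ‖N y - N v‖ ≤ M (|‖y‖ - ‖v‖| + ‖N v - N y‖)`
      have hdec : ‖y - v‖ ≤ M * (|‖y‖ - ‖v‖| + ‖‖v‖⁻¹ • v - ‖y‖⁻¹ • y‖) := by
        have e : y - v = (‖y‖ - ‖v‖) • (‖y‖⁻¹ • y) + ‖v‖ • (‖y‖⁻¹ • y - ‖v‖⁻¹ • v) := by
          rw [sub_smul, smul_sub, smul_inv_smul₀ (norm_ne_zero_iff.2 hy0),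
            smul_inv_smul₀ (norm_ne_zero_iff.2 hv0)]
          abel
        have hn1 : ‖‖y‖⁻¹ • y‖ = 1 := by
          rw [norm_smul, norm_inv, norm_norm, inv_mul_cancel₀ (norm_ne_zero_iff.2 hy0)]
        calc ‖y - v‖ = ‖(‖y‖ - ‖v‖) • (‖y‖⁻¹ • y) + ‖v‖ • (‖y‖⁻¹ • y - ‖v‖⁻¹ • v)‖ := by rw [← e]
          _ ≤ ‖(‖y‖ - ‖v‖) • (‖y‖⁻¹ • y)‖ + ‖‖v‖ • (‖y‖⁻¹ • y - ‖v‖⁻¹ • v)‖ := norm_add_le _ _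
          _ = |‖y‖ - ‖v‖| + ‖v‖ * ‖‖v‖⁻¹ • v - ‖y‖⁻¹ • y‖ := by
              rw [norm_smul, Real.norm_eq_abs, hn1, mul_one, norm_smul, Real.norm_eq_abs,
                abs_of_pos hvpos, norm_sub_rev]
          _ ≤ M * |‖y‖ - ‖v‖| + M * ‖‖v‖⁻¹ • v - ‖y‖⁻¹ • y‖ := by
              apply add_le_add
              · exact le_mul_of_one_le_left (abs_nonneg _) hM1
              · exact mul_le_mul_of_nonneg_right (le_max_right _ _) (norm_nonneg _)
          _ = M * (|‖y‖ - ‖v‖| + ‖‖v‖⁻¹ • v - ‖y‖⁻¹ • y‖) := by ring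
      have h3 : ‖y - v‖ ≤ M * K * ‖F y - F v‖ := by
        calc ‖y - v‖ ≤ M * (|‖y‖ - ‖v‖| + ‖‖v‖⁻¹ • v - ‖y‖⁻¹ • y‖) := hdec
          _ ≤ M * (K * ‖F y - F v‖) := mul_le_mul_of_nonneg_left hkey (by positivity)
          _ = M * K * ‖F y - F v‖ := by ring
      rw [div_mul_eq_mul_div, one_mul, div_le_iff₀ (by positivity)]
      nlinarith [norm_nonneg (F y - F v), norm_nonneg (y - v)]
  /- ── the image bound ── -/
  have hFbound : ∀ v ∈ ball (0 : V) (1 + δ), ‖F v‖ < 1 + ε := by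
    intro v hv
    rw [mem_ball_zero_iff] at hv
    by_cases hv0 : v = 0
    · rw [hv0, hF0, norm_zero]; linarith
    · have hvle : ‖v‖ ≤ 1 + ε₁ := by rw [hδ] at hv; linarith
      rw [hFnorm v hv0 hvle]
      -- `R ρ u = ρ + χ ρ (‖C(cl ρ N u)‖ - cl ρ)` with the defect `< ε₀/4 + ε₁`
      have hclv : |cl ‖v‖ - 1| ≤ ε₁ := hcl1 ‖v‖ hvle
      have hNv0 : ‖v‖⁻¹ • v ≠ 0 := smul_ne_zero (inv_ne_zero (norm_ne_zero_iff.2 hv0)) hv0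
      have hcl' : |cl ‖v‖ - 1| ≤ ε' := hclv.trans (by linarith)
      have h1 := hclose₂ (cl ‖v‖) hcl' (‖v‖⁻¹ • v) hNv0
      rw [normalize_normalize hv0] at h1
      have hn1 : ‖‖v‖⁻¹ • v‖ = 1 := by
        rw [norm_smul, norm_inv, norm_norm, inv_mul_cancel₀ (norm_ne_zero_iff.2 hv0)]
      have h2 : ‖C (cl ‖v‖ • (‖v‖⁻¹ • v))‖ < 1 + ε₀ / 4 := by
        have := norm_le_norm_add_norm_sub' (C (cl ‖v‖ • (‖v‖⁻¹ • v))) (‖v‖⁻¹ • v)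
        rw [hn1] at this
        linarith
      have h3 : ‖C (cl ‖v‖ • (‖v‖⁻¹ • v))‖ - cl ‖v‖ < ε₀ / 4 + ε₁ := by
        have := (abs_le.1 hclv).1
        linarith
      have hχ01 : 0 ≤ χ ‖v‖ ∧ χ ‖v‖ ≤ 1 := ⟨smoothTransition.nonneg _, smoothTransition.le_one _⟩
      have h4 : χ ‖v‖ * (‖C (cl ‖v‖ • (‖v‖⁻¹ • v))‖ - cl ‖v‖) ≤ ε₀ / 4 + ε₁ := by
        rcases le_or_gt 0 (‖C (cl ‖v‖ • (‖v‖⁻¹ • v))‖ - cl ‖v‖) with h | h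
        · calc χ ‖v‖ * (‖C (cl ‖v‖ • (‖v‖⁻¹ • v))‖ - cl ‖v‖)
              ≤ 1 * (‖C (cl ‖v‖ • (‖v‖⁻¹ • v))‖ - cl ‖v‖) := mul_le_mul_of_nonneg_right hχ01.2 h
            _ ≤ ε₀ / 4 + ε₁ := by linarith
        · have : χ ‖v‖ * (‖C (cl ‖v‖ • (‖v‖⁻¹ • v))‖ - cl ‖v‖) ≤ 0 :=
            mul_nonpos_of_nonneg_of_nonpos hχ01.1 h.le
          linarith
      have hR : R ‖v‖ (‖v‖⁻¹ • v) = ‖v‖ + χ ‖v‖ * (‖C (cl ‖v‖ • (‖v‖⁻¹ • v))‖ - cl ‖v‖) := by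
        simp only [hRdef, normalize_normalize hv0]
      rw [hR]
      have hε₁ε₀ : ε₁ ≤ ε₀ / 8 := by linarith
      have hδv : ‖v‖ < 1 + ε₁ / 2 := by rw [hδ] at hv; exact hv
      linarith
  have hFdinj : ∀ v ∈ ball (0 : V) (1 + δ), Injective (fderiv ℝ F v) := by
    intro v hv
    obtain ⟨c, hc, hco'⟩ := hcoLip v hv
    exact injective_of_coLipschitz_hasFDerivAt hc hco' (hFdiff v hv)
  /- ── the unit sphere is fixed and the open unit ball is mapped into itself ── -/
  have hFsph : ∀ v : V, ‖v‖ = 1 → F v = v := by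
    intro v hv
    rw [hFC v (by rw [hv]; linarith) (by rw [hv]; linarith)]
    exact hCid v hv
  have hR1 : ∀ u ∈ Metric.sphere (0 : V) 1, R 1 u = 1 := by
    intro u hu
    have hu1 : ‖u‖ = 1 := by simpa using hu
    have hcl1 : cl 1 = 1 := clamp_of_ge hε₁ (by linarith)
    have hχ1 : χ 1 = 1 := chi_eq_one (by norm_num)
    have hNu : ‖u‖⁻¹ • u = u := by rw [hu1, inv_one, one_smul]
    simp only [hRdef, hcl1, hχ1, one_mul]
    rw [hNu, one_smul, hCid u hu1, hu1]
    ring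
  have hFin : ∀ v : V, ‖v‖ < 1 → ‖F v‖ < 1 := by
    intro v hv
    by_cases hv0 : v = 0
    · rw [hv0, hF0, norm_zero]; exact one_pos
    · have hvpos : 0 < ‖v‖ := norm_pos_iff.2 hv0
      rw [hFnorm v hv0 (by linarith)]
      have h := hgrowth ‖v‖ ⟨hvpos, by linarith⟩ 1 ⟨one_pos, by linarith⟩ hv.le (‖v‖⁻¹ • v)
        (hNsph v hv0)
      rw [hR1 _ (hNsph v hv0)] at h
      linarith
  /- ── the closed unit ball is mapped onto itself ── -/
  have hsurj : closedBall (0 : V) 1 ⊆ F '' closedBall (0 : V) 1 := by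
    set W : Set V := F '' ball (0 : V) 1 with hW
    -- `W ⊆ ball 0 1`
    have hWsub : W ⊆ ball (0 : V) 1 := by
      rintro _ ⟨v, hv, rfl⟩
      rw [mem_ball_zero_iff] at hv ⊢
      exact hFin v hv
    -- `W` is open (inverse function theorem at each point)
    have hWopen : IsOpen W := by
      rw [isOpen_iff_mem_nhds]
      rintro _ ⟨v, hv, rfl⟩
      have hvδ : v ∈ ball (0 : V) (1 + δ) := by
        rw [mem_ball_zero_iff] at hv ⊢; linarith
      have hstrict : HasStrictFDerivAt F (fderiv ℝ F v) v :=
        (hFsmooth.contDiffAt (isOpen_ball.mem_nhds hvδ)).hasStrictFDerivAt (by simp)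
      have hsurjd : Surjective (fderiv ℝ F v) :=
        (LinearMap.injective_iff_surjective (f := (fderiv ℝ F v).toLinearMap)).1 (hFdinj v hvδ)
      set e : V ≃L[ℝ] V := ContinuousLinearEquiv.ofBijective (fderiv ℝ F v)
        (LinearMap.ker_eq_bot.2 (hFdinj v hvδ)) (LinearMap.range_eq_top.2 hsurjd) with he
      have hstrict' : HasStrictFDerivAt F (e : V →L[ℝ] V) v := hstrict
      have hmap := hstrict'.map_nhds_eq_of_equiv
      have h1 : F '' ball (0 : V) 1 ∈ Filter.map F (𝓝 v) :=
        Filter.image_mem_map (isOpen_ball.mem_nhds hv)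
      rwa [hmap] at h1
    -- `closure W ⊆ F '' closedBall 0 1`, a compact set
    have hFcont : ContinuousOn F (closedBall (0 : V) 1) :=
      hFsmooth.continuousOn.mono (closedBall_subset_ball (by linarith))
    have hKc : IsCompact (F '' closedBall (0 : V) 1) :=
      (isCompact_closedBall (0 : V) 1).image_of_continuousOn hFcont
    have hclW : closure W ⊆ F '' closedBall (0 : V) 1 :=
      closure_minimal (image_mono ball_subset_closedBall) hKc.isClosed
    -- points of `ball 0 1 ∩ closure W` lie in `W`
    have hclW' : ball (0 : V) 1 ∩ closure W ⊆ W := by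
      rintro w ⟨hw, hwc⟩
      obtain ⟨v, hv, rfl⟩ := hclW hwc
      rw [mem_closedBall_zero_iff] at hv
      rcases hv.lt_or_eq with hlt | heq
      · exact ⟨v, by rwa [mem_ball_zero_iff], rfl⟩
      · exfalso
        rw [hFsph v heq, mem_ball_zero_iff, heq] at hw
        exact lt_irrefl _ hw
    -- connectedness of the ball: `ball 0 1 ⊆ W`
    have hballW : ball (0 : V) 1 ⊆ W := by
      have hpre : IsPreconnected (ball (0 : V) 1) := (convex_ball (0 : V) 1).isPreconnected
      have hcover : ball (0 : V) 1 ⊆ W ∪ (closure W)ᶜ := by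
        intro w hw
        by_cases hwc : w ∈ closure W
        · exact Or.inl (hclW' ⟨hw, hwc⟩)
        · exact Or.inr hwc
      have hdisj : Disjoint W (closure W)ᶜ :=
        disjoint_compl_right.mono_left subset_closure
      have hne : (ball (0 : V) 1 ∩ W).Nonempty :=
        ⟨0, by rw [mem_ball_zero_iff, norm_zero]; exact one_pos,
          ⟨0, by rw [mem_ball_zero_iff, norm_zero]; exact one_pos, hF0⟩⟩
      exact hpre.subset_left_of_subset_union hWopen isClosed_closure.isOpen_compl hdisj hcover hne
    intro y hy
    rw [mem_closedBall_zero_iff] at hy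
    rcases hy.lt_or_eq with hlt | heq
    · obtain ⟨v, hv, hvy⟩ := hballW (by rwa [mem_ball_zero_iff])
      exact ⟨v, ball_subset_closedBall hv, hvy⟩
    · exact ⟨y, by rw [mem_closedBall_zero_iff, heq], hFsph y heq⟩
  exact ⟨δ, hδpos, by rw [hδ]; linarith, F, hFsmooth, hFid, hFC, hFinj, hFdinj, hFbound, hFin,
    hFsph, hsurj⟩

/-- **The interior surgery map, with image bound.** As `exists_unwinding_extension`, and moreover
`‖F v‖ < 1 + ε` on the ball (the image stays in the annulus' outer ball).
[cite: Weinstein1968, proof of the main theorem, step (3)] -/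
theorem exists_unwinding_extension_norm_lt {C : V → V} {ε : ℝ} (hε : 0 < ε)
    (hCs : ContDiffOn ℝ ∞ C {v : V | 1 - ε < ‖v‖ ∧ ‖v‖ < 1 + ε})
    (hCid : ∀ u : V, ‖u‖ = 1 → C u = u) (hCtr : ∀ u : V, ‖u‖ = 1 → 1 ≤ ⟪u, fderiv ℝ C u u⟫) :
    ∃ δ : ℝ, 0 < δ ∧ δ < ε ∧ ∃ F : V → V,
      ContDiffOn ℝ ∞ F (ball (0 : V) (1 + δ)) ∧
      (∀ v : V, ‖v‖ ≤ 1 / 3 → F v = v) ∧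
      (∀ v : V, 1 - δ ≤ ‖v‖ → ‖v‖ < 1 + δ → F v = C v) ∧
      InjOn F (ball (0 : V) (1 + δ)) ∧
      (∀ v ∈ ball (0 : V) (1 + δ), Injective (fderiv ℝ F v)) ∧
      (∀ v ∈ ball (0 : V) (1 + δ), ‖F v‖ < 1 + ε) := by
  obtain ⟨δ, hδ, hδε, F, h1, h2, h3, h4, h5, h6, -⟩ := exists_unwinding_extension_ball hε hCs hCid hCtr
  exact ⟨δ, hδ, hδε, F, h1, h2, h3, h4, h5, h6⟩

/-- **The interior surgery map.** See the module docstring.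
[cite: Weinstein1968, proof of the main theorem, step (3)] -/
theorem exists_unwinding_extension {C : V → V} {ε : ℝ} (hε : 0 < ε)
    (hCs : ContDiffOn ℝ ∞ C {v : V | 1 - ε < ‖v‖ ∧ ‖v‖ < 1 + ε})
    (hCid : ∀ u : V, ‖u‖ = 1 → C u = u) (hCtr : ∀ u : V, ‖u‖ = 1 → 1 ≤ ⟪u, fderiv ℝ C u u⟫) :
    ∃ δ : ℝ, 0 < δ ∧ δ < ε ∧ ∃ F : V → V,
      ContDiffOn ℝ ∞ F (ball (0 : V) (1 + δ)) ∧
      (∀ v : V, ‖v‖ ≤ 1 / 3 → F v = v) ∧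
      (∀ v : V, 1 - δ ≤ ‖v‖ → ‖v‖ < 1 + δ → F v = C v) ∧
      InjOn F (ball (0 : V) (1 + δ)) ∧
      (∀ v ∈ ball (0 : V) (1 + δ), Injective (fderiv ℝ F v)) := by
  obtain ⟨δ, hδ, hδε, F, h1, h2, h3, h4, h5, -⟩ := exists_unwinding_extension_norm_lt hε hCs hCid hCtr
  exact ⟨δ, hδ, hδε, F, h1, h2, h3, h4, h5⟩

end Literature.Geometry.Riemannian

end
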